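import Summits.ABC.ABC.Theses.IsogenyGlueCongruence
import Literature.NumberTheory.EllipticCurves.ModularCurveManinSemistableCoprimeFormProofs

/-!
# `PolyHeightOfBoundedPrimes` (stmt-ABC-16006, crux B′) — line `Sketch` (card `archimedean-hall-split`):
the registered CALIBRATION stub `stub_polyHallDelta_of_polyHall` (engine interface of the Hall half)

Crux `B′ = A → H` of route IsogenyGlueCongruence (`H`: `max(|Δ_W|, |c₄(W)|³) ≤ C·N_W^σ` on semistable
global minimal elliptic `W/ℚ`). The line splits `H` into a finite half `PolySzpiroΔ` and an
archimedean "Hall half" `PolyHallΔ : ∃ σ' C, 0 ≤ σ' ∧ ∀ W, |c₄(W)|³ ≤ C·|Δ_W|^{σ'}`. This file lands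

* `abs_pow_three_le_of_hall` — the real-power bookkeeping `c·X^θ ≤ 1728·D ⟹ X³ ≤ (1728/c)^{3/θ}·D^{3/θ}`;
* `polyHallDelta_of_polyHall` — pointwise, curried: a weak Hall bound with exponent `θ > 0` and constant
  `c > 0` gives `|c₄(W)|³ ≤ (1728/c)^{3/θ} · |Δ_W|^{3/θ}` for every elliptic `W/ℚ` in global minimal form;
* `stub_polyHallDelta_of_polyHall` — the REGISTERED stub (name and signature verbatim): ANY weak Hall
  inequality with a power saving (`c·|x|^θ ≤ |x³ − y²|` for all integers with `x³ ≠ y²`, some `θ > 0`,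
  `c > 0`) gives `PolyHallΔ` with `σ' = 3/θ`, `C = (1728/c)^{3/θ}`.

Proof. Let `W₀ = integralModelInt W` be the integral global minimal model (`W₀ ⊗ ℚ = W`), and put
`x = c₄(W₀)`, `y = c₆(W₀) ∈ ℤ`; then `(x : ℚ) = c₄(W)`, `(Δ(W₀) : ℚ) = Δ(W)` and
`1728·Δ(W₀) = x³ − y²` (`WeierstrassCurve.c_relation` over `ℤ`). Since `W` is elliptic, `Δ(W) ≠ 0`, so
`x³ ≠ y²` and the Hall datum gives `c·|x|^θ ≤ |x³ − y²| = 1728·|Δ(W₀)|`, i.e. `|x|^θ ≤ (1728/c)·|Δ_W|`;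
raising to the power `3/θ ≥ 0`: `|c₄(W)|³ = (|x|^θ)^{3/θ} ≤ (1728/c)^{3/θ} · |Δ_W|^{3/θ}`.
Semistability and `NeZero (W.conductorNorm ℤ)` are not used (the Hall half is `N`-free).

Supports stmt-ABC-16006 (registered stub verbatim; curried pointwise form `polyHallDelta_of_polyHall`).
Nothing here closes the item.
-/

noncomputable section

-- single-conjunct summit ABC: the duplicate ABC.ABC is mandated (CONVENTIONS §2)
set_option linter.dupNamespace false

namespace Summit.ABC.ABC.Theorems.PolyHeightOfBoundedPrimes.HallSplit

open WeierstrassCurve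
open Summit.ABC.ABC.Theses.IsogenyGlueCongruence

/-- **Real-power bookkeeping.** If `c·X^θ ≤ 1728·D` with `0 < θ`, `0 < c`, `0 ≤ X`, `0 ≤ D`, then
`X³ ≤ (1728/c)^{3/θ} · D^{3/θ}` (`X³ = (X^θ)^{3/θ}`, monotonicity of `t ↦ t^{3/θ}`). [folklore] -/
theorem abs_pow_three_le_of_hall {θ c X D : ℝ} (hθ : 0 < θ) (hc : 0 < c) (hX : 0 ≤ X) (hD : 0 ≤ D)
    (h : c * X ^ θ ≤ 1728 * D) :
    X ^ 3 ≤ (1728 / c) ^ (3 / θ) * D ^ (3 / θ) := by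
  have hXθ : X ^ θ ≤ 1728 / c * D := by
    rw [div_mul_eq_mul_div, le_div_iff₀ hc]
    calc X ^ θ * c = c * X ^ θ := mul_comm _ _
      _ ≤ 1728 * D := h
  have hθ3 : (0 : ℝ) ≤ 3 / θ := by positivity
  have hk0 : (0 : ℝ) ≤ 1728 / c := by positivity
  calc X ^ 3 = X ^ (3 : ℝ) := (Real.rpow_ofNat X 3).symm
    _ = (X ^ θ) ^ (3 / θ) := by
        rw [← Real.rpow_mul hX]
        congr 1
        field_simp
    _ ≤ (1728 / c * D) ^ (3 / θ) := Real.rpow_le_rpow (Real.rpow_nonneg hX _) hXθ hθ3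
    _ = (1728 / c) ^ (3 / θ) * D ^ (3 / θ) := Real.mul_rpow hk0 hD

/-- **Weak Hall ⟹ Hall half, pointwise (curried form).** A weak Hall bound `c·|x|^θ ≤ |x³ − y²|`
(integers `x, y` with `x³ ≠ y²`; `θ > 0`, `c > 0`) gives, for every elliptic `W/ℚ` in global minimal form,
`|c₄(W)|³ ≤ (1728/c)^{3/θ} · |Δ_W|^{3/θ}`: apply it to the integers `x = c₄(W₀)`, `y = c₆(W₀)` of the
integral model `W₀ = integralModelInt W`, where `1728·Δ(W₀) = x³ − y² ≠ 0`. [folklore] -/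
theorem polyHallDelta_of_polyHall {θ c : ℝ} (hθ : 0 < θ) (hc : 0 < c)
    (hHall : ∀ x y : ℤ, x ^ 3 ≠ y ^ 2 → c * |(x : ℝ)| ^ θ ≤ |((x : ℝ) ^ 3 - (y : ℝ) ^ 2)|)
    (W : WeierstrassCurve ℚ) [W.IsElliptic] [W.IsGloballyMinimal] :
    ((|W.c₄| ^ 3 : ℚ) : ℝ) ≤ (1728 / c) ^ (3 / θ) * ((|W.Δ| : ℚ) : ℝ) ^ (3 / θ) := by
  -- the integral global minimal model and its integral invariants
  have hrel : 1728 * (integralModelInt W).Δ =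
      (integralModelInt W).c₄ ^ 3 - (integralModelInt W).c₆ ^ 2 :=
    (integralModelInt W).c_relation
  have hΔ0 : (integralModelInt W).Δ ≠ 0 := by
    intro h0
    apply W.isUnit_Δ.ne_zero
    rw [← cast_integralModelInt_Δ W, h0, Int.cast_zero]
  have hxy : (integralModelInt W).c₄ ^ 3 ≠ (integralModelInt W).c₆ ^ 2 := by
    intro h
    apply hΔ0
    have h1 : (1728 : ℤ) * (integralModelInt W).Δ = 0 := by rw [hrel, h, sub_self]
    exact (mul_eq_zero.mp h1).resolve_left (by norm_num)
  have key := hHall _ _ hxy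
  have hrhs : |(((integralModelInt W).c₄ : ℝ) ^ 3 - ((integralModelInt W).c₆ : ℝ) ^ 2)| =
      1728 * |((integralModelInt W).Δ : ℝ)| := by
    have h1 : ((integralModelInt W).c₄ : ℝ) ^ 3 - ((integralModelInt W).c₆ : ℝ) ^ 2 =
        1728 * ((integralModelInt W).Δ : ℝ) := by exact_mod_cast hrel.symm
    rw [h1, abs_mul, abs_of_pos (by norm_num : (0 : ℝ) < 1728)]
  have hc4 : ((|W.c₄| ^ 3 : ℚ) : ℝ) = |((integralModelInt W).c₄ : ℝ)| ^ 3 := by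
    rw [← cast_integralModelInt_c₄ W]; push_cast; rfl
  have hΔ : ((|W.Δ| : ℚ) : ℝ) = |((integralModelInt W).Δ : ℝ)| := by
    rw [← cast_integralModelInt_Δ W]; push_cast; rfl
  rw [hc4, hΔ]
  exact abs_pow_three_le_of_hall hθ hc (abs_nonneg _) (abs_nonneg _) (key.trans_eq hrhs)

/-- **CALIBRATION STUB (registered on stmt-ABC-16006; line `Sketch`, card archimedean-hall-split):
engine interface of the Hall half.** A weak Hall inequality with ANY exponent `θ > 0` —
`c · |x|^θ ≤ |x³ − y²|` for all integers with `x³ ≠ y²` — gives the Hall half `PolyHallΔ` with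
`σ' = 3/θ`, `C = (1728/c)^{3/θ}`: on the integral global minimal model `1728Δ = c₄³ − c₆² ≠ 0`.
The Hall half is thus a pure Diophantine statement about the Mordell curves `Y² = X³ − 1728Δ`
(`N` does not occur; semistability is not used). [folklore] -/
theorem stub_polyHallDelta_of_polyHall :
    (∃ θ c : ℝ, 0 < θ ∧ 0 < c ∧ ∀ x y : ℤ, x ^ 3 ≠ y ^ 2 →
      c * |(x : ℝ)| ^ θ ≤ |((x : ℝ) ^ 3 - (y : ℝ) ^ 2)|) →
    ∃ σ C : ℝ, 0 ≤ σ ∧ ∀ (W : WeierstrassCurve ℚ) [W.IsElliptic] [W.IsGloballyMinimal]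
      [NeZero (W.conductorNorm ℤ)], W.IsSemistable ℤ →
        ((|W.c₄| ^ 3 : ℚ) : ℝ) ≤ C * ((|W.Δ| : ℚ) : ℝ) ^ σ := by
  rintro ⟨θ, c, hθ, hc, hHall⟩
  exact ⟨3 / θ, (1728 / c) ^ (3 / θ), by positivity,
    fun W _ _ _ _hW ↦ polyHallDelta_of_polyHall hθ hc hHall W⟩

end Summit.ABC.ABC.Theorems.PolyHeightOfBoundedPrimes.HallSplit

end
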